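import Summits.QuantumFields.QCD.Theses.QuarksNoInfraredClause
import Literature.MathematicalPhysics.QuantumFieldTheory.QCDFlavourSymmetry
import Literature.MathematicalPhysics.QuantumFieldTheory.QCDGoldstoneBound
import Literature.MathematicalPhysics.QuantumFieldTheory.QCDCalibratedSpecies
import HarnessLib

/-!
# Line `registered` of crux `ThinQCD` (item stmt-QuantumFields-17278, route
route-QuantumFields-QuarksNoInfraredClause): the CLOSED diagonal-subsequence reduction of the UV window
law S2 to the compactness-ready stub `stub_uvCompactnessReady` (skeleton r2)

The stub (S2 of `Cruxes/ThinQCD/Lines/birth.lean`) asks, for every honest-looking regularisation `reg`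
of `N_f = 2, 3` lattice QCD, ONE reindexing `φ → ∞` along which, at EVERY positive mass tuple `m`,
species renormalisations `z, shift` and OS data `T` exist with
`IsQCDAlong ((reg.restrict φ hφ).scheme m z shift) T` and the three lattice-side UV windows.  That is
the UV half of the construction of QCD (k-uniform control of the renormalised composite fields with
light dynamical Wilson quarks — proved for no 4d gauge theory) and is NOT proved here.  This support
file lands the part of its intended proof that is pure bookkeeping and closes now:

* §1 `exists_strictMono_forall_tendsto` — countably many eventually bounded complex sequences have ONE
  common strictly increasing subsequence along which they all converge (Tychonoff in `∏ closedBall`,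
  first countability of a countable product); `exists_strictMono_forall_tendsto_of_equicontinuous` —
  the Arzelà–Ascoli upgrade in a parameter ranging over a separable pseudo-metric space: pointwise
  eventual bounds + equicontinuity at every point eventually-uniformly in the index give ONE
  subsequence serving EVERY parameter value (diagonal over a countable dense set + an `ε/3` Cauchy
  argument).
* §2 reindexing bookkeeping for `QCDRegularisation.restrict`: the lattice `n`-point functions of the
  reindexed regularisation with reindexed species data ARE the reindexed `n`-point functions
  (`qcdLatticeSchwinger_restrict_scheme`, `rfl`); asymptotic scaling and the physical branch pass to
  every `(reg.restrict φ hφ).scheme m z shift` with `m ≥ 0`; an eventual lower bound (a UV-window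
  clause) passes to the reindexing; and `isQCDAlong_restrict_scheme` — `IsQCDAlong` for the reindexed
  scheme is EXACTLY convergence of the original lattice functions along `φ` to the Schwinger
  functions of `T` (plus the two scheme-side clauses, inherited).
* §3 the diagonal step of S2 in the tree's vocabulary: `exists_restrict_forall_tendsto` — for countably
  many data `(m, z, shift, n, σ, f)` with k-eventually bounded lattice functions there is ONE `φ`
  (strictly increasing) along which all of them converge; `exists_strictMono_forall_mass_tendsto` —
  if the species data `z m, shift m` are chosen as functions of the mass and the family is
  MASS-EQUICONTINUOUS (`IsMassEquicontinuous`, the tree's Arzelà–Ascoli modulus) with pointwise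
  k-eventual bounds on countably many test data, ONE `φ` serves EVERY positive mass tuple at once —
  the quantifier shape `∃ φ, ∀ m > 0` of the stub.

What remains of S2 after this file (recorded in the crux notes): the k-uniform bounds themselves
(fermionic UV stability with observables, `DiagonalSpine.CalibratedTightness`-type), mass-equicontinuity
(`DiagonalSpine.MassEquicontinuity`-type), the extension from countably many test data to all
off-diagonal tensors (E0′-equicontinuity + separability), the OS axioms of the limit (`OSData`: E0′,
E1 = rotation restoration, E2, E3, E4) and the three UV-window lower bounds.  No definition, no named
fact, no `sorry`.
-/

noncomputable section

namespace Summit.QuantumFields.QCD.Cruxes.ThinQCD.Registered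

open scoped Topology SchwartzMap
open Filter
open Literature.MathematicalPhysics.QuantumFieldTheory Literature.MathematicalPhysics.QuantumLattice
  Literature.MathematicalPhysics.AQFT

/-! ### §1 Abstract diagonal lemmas -/

section Diagonal

/-- An eventually bounded complex sequence is bounded. [folklore] -/
theorem exists_forall_norm_le_of_eventually {x : ℕ → ℂ} {R : ℝ} (h : ∀ᶠ k in atTop, ‖x k‖ ≤ R) :
    ∃ R' : ℝ, ∀ k, ‖x k‖ ≤ R' := by
  obtain ⟨N, hN⟩ := eventually_atTop.1 h
  refine ⟨max R (∑ j ∈ Finset.range N, ‖x j‖), fun k => ?_⟩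
  rcases lt_or_ge k N with hk | hk
  · exact (Finset.single_le_sum (f := fun j => ‖x j‖) (fun j _ => norm_nonneg (x j))
      (Finset.mem_range.2 hk)).trans (le_max_right _ _)
  · exact (hN k hk).trans (le_max_left _ _)

/-- **One subsequence for countably many bounded sequences** (Bolzano–Weierstrass + Cantor diagonal,
here as Tychonoff in `∏ᵢ closedBall 0 Rᵢ` plus first countability of a countable product): if each of
countably many complex sequences `x i` is eventually bounded, there is ONE strictly increasing
`φ : ℕ → ℕ` along which every `x i ∘ φ` converges. [folklore] -/
theorem exists_strictMono_forall_tendsto {ι : Type*} [Countable ι] (x : ι → ℕ → ℂ)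
    (hx : ∀ i, ∃ R : ℝ, ∀ᶠ k in atTop, ‖x i k‖ ≤ R) :
    ∃ φ : ℕ → ℕ, StrictMono φ ∧ ∀ i, ∃ l : ℂ, Tendsto (fun k => x i (φ k)) atTop (𝓝 l) := by
  have hb : ∀ i, ∃ R : ℝ, ∀ k, ‖x i k‖ ≤ R := fun i => by
    obtain ⟨R, hR⟩ := hx i
    exact exists_forall_norm_le_of_eventually hR
  choose R hR using hb
  have hS : IsCompact (Set.pi Set.univ fun i : ι => Metric.closedBall (0 : ℂ) (R i)) :=
    isCompact_univ_pi fun i => isCompact_closedBall _ _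
  have hmem : ∀ k, (fun i => x i k) ∈ Set.pi Set.univ fun i : ι => Metric.closedBall (0 : ℂ) (R i) :=
    fun k i _ => by simpa only [Metric.mem_closedBall, dist_zero_right] using hR i k
  obtain ⟨a, -, φ, hφ, hlim⟩ := hS.tendsto_subseq hmem
  exact ⟨φ, hφ, fun i => ⟨a i, ((continuous_apply i).tendsto a).comp hlim⟩⟩

/-- **Arzelà–Ascoli in a parameter, diagonal form.** Let `F k i x ∈ ℂ` depend on a cutoff index `k`,
a countable label `i` and a parameter `x` in a separable pseudo-metric space. If every `k ↦ F k i x`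
is eventually bounded and the family is equicontinuous at every point eventually-uniformly in `k`
(`∀ ε > 0, ∃ δ > 0, ∀ᶠ k, ∀ y, dist x y < δ → ‖F k i x − F k i y‖ < ε`), then ONE strictly increasing
`φ` makes `k ↦ F (φ k) i x` converge for EVERY `i` and EVERY `x`: diagonalise over `ι × D`, `D` a
countable dense set, and run the `ε/3` argument (the limit sequence at `x` is Cauchy). [folklore] -/
theorem exists_strictMono_forall_tendsto_of_equicontinuous {ι : Type*} [Countable ι] {X : Type*}
    [PseudoMetricSpace X] [TopologicalSpace.SeparableSpace X] (F : ℕ → ι → X → ℂ)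
    (hb : ∀ i x, ∃ R : ℝ, ∀ᶠ k in atTop, ‖F k i x‖ ≤ R)
    (heq : ∀ i x, ∀ ε > (0 : ℝ), ∃ δ > (0 : ℝ), ∀ᶠ k in atTop, ∀ y, dist x y < δ →
      ‖F k i x - F k i y‖ < ε) :
    ∃ φ : ℕ → ℕ, StrictMono φ ∧ ∀ i x, ∃ l : ℂ, Tendsto (fun k => F (φ k) i x) atTop (𝓝 l) := by
  obtain ⟨D, hDc, hDd⟩ := TopologicalSpace.exists_countable_dense X
  haveI : Countable D := hDc.to_subtype
  obtain ⟨φ, hφ, hlim⟩ :=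
    exists_strictMono_forall_tendsto (fun p : ι × D => fun k => F k p.1 (p.2 : X)) fun p => hb p.1 p.2
  refine ⟨φ, hφ, fun i x => cauchySeq_tendsto_of_complete (Metric.cauchySeq_iff.2 fun ε hε => ?_)⟩
  have hε3 : 0 < ε / 3 := by positivity
  obtain ⟨δ, hδ, hk⟩ := heq i x (ε / 3) hε3
  obtain ⟨d, hdD, hxd⟩ := hDd.exists_dist_lt x hδ
  obtain ⟨l, hl⟩ := hlim (i, ⟨d, hdD⟩)
  obtain ⟨N₁, hN₁⟩ := Metric.cauchySeq_iff.1 hl.cauchySeq (ε / 3) hε3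
  obtain ⟨N₂, hN₂⟩ := eventually_atTop.1 (hφ.tendsto_atTop.eventually hk)
  refine ⟨max N₁ N₂, fun m hm n hn => ?_⟩
  have hm₁ : N₁ ≤ m := (le_max_left _ _).trans hm
  have hn₁ : N₁ ≤ n := (le_max_left _ _).trans hn
  have hm₂ : N₂ ≤ m := (le_max_right _ _).trans hm
  have hn₂ : N₂ ≤ n := (le_max_right _ _).trans hn
  have h1 : dist (F (φ m) i x) (F (φ m) i d) < ε / 3 := by
    rw [dist_eq_norm]; exact hN₂ m hm₂ d hxd
  have h2 : dist (F (φ m) i d) (F (φ n) i d) < ε / 3 := hN₁ m hm₁ n hn₁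
  have h3 : dist (F (φ n) i d) (F (φ n) i x) < ε / 3 := by
    rw [dist_comm, dist_eq_norm]; exact hN₂ n hn₂ d hxd
  calc dist (F (φ m) i x) (F (φ n) i x)
      ≤ dist (F (φ m) i x) (F (φ m) i d) + dist (F (φ m) i d) (F (φ n) i d) +
          dist (F (φ n) i d) (F (φ n) i x) := dist_triangle4 _ _ _ _
    _ < ε / 3 + ε / 3 + ε / 3 := by gcongr
    _ = ε := by ring

end Diagonal

/-! ### §2 Reindexing bookkeeping for `QCDRegularisation.restrict` -/

section Restrict

variable {Nf : ℕ} (reg : QCDRegularisation Nf) (φ : ℕ → ℕ) (hφ : Tendsto φ atTop atTop)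

/-- **The lattice `n`-point functions of the reindexed regularisation with reindexed species data are
the reindexed lattice `n`-point functions** (definitional: spacing, coupling, torus, bare masses and
`z, shift` at step `k` of the left side are those at step `φ k` of the right side). [folklore] -/
theorem qcdLatticeSchwinger_restrict_scheme (m : Fin Nf → ℝ) (z shift : QCDField Nf → ℕ → ℝ)
    (k n : ℕ) (σ : Fin n → QCDField Nf) (f : Fin n → 𝓢(EuclideanSpace ℝ (Fin 4), ℝ)) :
    qcdLatticeSchwinger ((reg.restrict φ hφ).scheme m (fun s j => z s (φ j)) (fun s j => shift s (φ j)))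
        k n σ f =
      qcdLatticeSchwinger (reg.scheme m z shift) (φ k) n σ f :=
  rfl

/-- Two-loop asymptotic scaling reads only `β_k, a_k`: it passes from `reg.scheme 0 0 0` to every
scheme of the reindexed regularisation. [folklore] -/
theorem hasAsymptoticScaling_restrict_scheme (h : (reg.scheme 0 0 0).HasAsymptoticScaling)
    (m : Fin Nf → ℝ) (z shift : QCDField Nf → ℕ → ℝ) :
    ((reg.restrict φ hφ).scheme m z shift).HasAsymptoticScaling := by
  obtain ⟨Λ, hΛ, ht⟩ := h
  exact ⟨Λ, hΛ, ht.comp hφ⟩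

/-- **The physical branch is inherited**: if the bare trajectory `m_f(k) = m_crit(k) + a_k m_f / Z_m(k)`
of the tuple `m` is eventually `> −1` (the per-mass branch clause, as in `DiagonalSpine.FullLatticeGap`),
so is the trajectory of the reindexed regularisation with any species data (it IS the reindexed
trajectory, `QCDRegularisation.restrict_scheme_mq`). [folklore] -/
theorem eventually_neg_one_lt_mq_restrict_scheme {m : Fin Nf → ℝ}
    (h : ∀ f, ∀ᶠ k in atTop, (-1 : ℝ) < (reg.scheme m 0 0).mq f k)
    (z shift : QCDField Nf → ℕ → ℝ) (f : Fin Nf) :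
    ∀ᶠ k in atTop, (-1 : ℝ) < ((reg.restrict φ hφ).scheme m z shift).mq f k :=
  (hφ.eventually (h f)).mono fun _ hk => hk

/-- **An eventual lower bound passes to the reindexing** (the shape of each UV-window clause: if
`ε ≤ ‖G k‖` eventually in `k`, then `ε ≤ ‖G (φ k)‖` eventually in `k`, because `φ → ∞`). [folklore] -/
theorem eventually_comp_of_eventually {P : ℕ → Prop} (hφ' : Tendsto φ atTop atTop)
    (h : ∀ᶠ k in atTop, P k) : ∀ᶠ k in atTop, P (φ k) :=
  hφ'.eventually h

/-- **`IsQCDAlong` for the reindexed scheme is convergence along `φ`.** If `reg` scales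
asymptotically, the bare trajectory of the tuple `m` is eventually on the physical branch, and ALONG
`φ` the lattice `n`-point functions of `reg.scheme m z shift` converge on off-diagonal real tensors to
the Schwinger functions of the OS data `T`, then `T` is QCD along
`(reg.restrict φ hφ).scheme m (z ∘ φ) (shift ∘ φ)`.  This isolates what S2 still owes: the convergence
(compactness needs k-uniform bounds) and the OS axioms packaged in `T`. [folklore] -/
theorem isQCDAlong_restrict_scheme (has : (reg.scheme 0 0 0).HasAsymptoticScaling)
    {m : Fin Nf → ℝ} (hbr : ∀ f, ∀ᶠ k in atTop, (-1 : ℝ) < (reg.scheme m 0 0).mq f k)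
    (z shift : QCDField Nf → ℕ → ℝ) (T : OSData (QCDField Nf) 4)
    (hconv : ∀ n : ℕ, n ≠ 0 → ∀ (σ : Fin n → QCDField Nf) (f : Fin n → 𝓢(EuclideanSpace ℝ (Fin 4), ℝ))
      (F : 𝓢((Fin n → EuclideanSpace ℝ (Fin 4)), ℂ)), IsTensorOf F (fun i => ofRealTest (f i)) →
        IsOffDiagonal F →
          Tendsto (fun k => qcdLatticeSchwinger (reg.scheme m z shift) (φ k) n σ f) atTop
            (𝓝 (T.schwinger n σ F))) :
    IsQCDAlong ((reg.restrict φ hφ).scheme m (fun s j => z s (φ j)) (fun s j => shift s (φ j))) T :=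
  ⟨hasAsymptoticScaling_restrict_scheme reg φ hφ has m _ _,
    fun fl => eventually_neg_one_lt_mq_restrict_scheme reg φ hφ hbr _ _ fl,
    fun n hn σ f F hF hO => (hconv n hn σ f F hF hO).congr fun k =>
      (qcdLatticeSchwinger_restrict_scheme reg φ hφ m z shift k n σ f).symm⟩

end Restrict

/-! ### §3 The diagonal step of S2 over the tree's vocabulary -/

section DiagonalQCD

variable {Nf : ℕ} (reg : QCDRegularisation Nf)

/-- **One reindexing for countably many lattice data.** For a regularisation `reg` and countably many
data `i ↦ (m i, z i, shift i, n i, σ i, f i)` whose lattice `n i`-point functions are eventually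
bounded in the cutoff index, there is ONE strictly increasing `φ` (so `φ → ∞`) along which all of
them converge — stated for the reindexed regularisation `reg.restrict φ _` with the reindexed species
data, i.e. in the shape `IsQCDAlong` consumes. [folklore] -/
theorem exists_restrict_forall_tendsto {ι : Type*} [Countable ι] (m : ι → Fin Nf → ℝ)
    (z shift : ι → QCDField Nf → ℕ → ℝ) (n : ι → ℕ) (σ : (i : ι) → Fin (n i) → QCDField Nf)
    (f : (i : ι) → Fin (n i) → 𝓢(EuclideanSpace ℝ (Fin 4), ℝ))
    (hb : ∀ i, ∃ R : ℝ, ∀ᶠ k in atTop,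
      ‖qcdLatticeSchwinger (reg.scheme (m i) (z i) (shift i)) k (n i) (σ i) (f i)‖ ≤ R) :
    ∃ (φ : ℕ → ℕ) (hφ : StrictMono φ), ∀ i, ∃ l : ℂ,
      Tendsto (fun k => qcdLatticeSchwinger ((reg.restrict φ hφ.tendsto_atTop).scheme (m i)
        (fun s j => z i s (φ j)) (fun s j => shift i s (φ j))) k (n i) (σ i) (f i)) atTop (𝓝 l) := by
  obtain ⟨φ, hφ, hlim⟩ := exists_strictMono_forall_tendsto
    (fun i k => qcdLatticeSchwinger (reg.scheme (m i) (z i) (shift i)) k (n i) (σ i) (f i)) hb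
  exact ⟨φ, hφ, fun i => hlim i⟩

/-- The positive orthant of mass tuples. [folklore] -/
theorem isOpen_setOf_forall_pos : IsOpen {m : Fin Nf → ℝ | ∀ fl, 0 < m fl} := by
  have : {m : Fin Nf → ℝ | ∀ fl, 0 < m fl} = ⋂ fl, {m | 0 < m fl} := by
    ext m; simp
  rw [this]
  exact isOpen_iInter_of_finite fun fl => isOpen_lt continuous_const (continuous_apply fl)

/-- **One reindexing serves every positive mass tuple** (the `∃ φ, ∀ m > 0` shape of S2, from the
tree's Arzelà–Ascoli modulus). Let the species data be chosen as functions `z m, shift m` of the mass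
tuple, MASS-EQUICONTINUOUSLY (`IsMassEquicontinuous reg z shift`: Lipschitz in `m` on compacts of
positive tuples, uniformly in `k`), and suppose that for countably many test data `i ↦ (n i, σ i, f i)`
(`n i ≥ 1`) the lattice functions are eventually bounded in `k` at every positive tuple. Then ONE
strictly increasing `φ` makes `k ↦ qcdLatticeSchwinger (reg.scheme m (z m) (shift m)) (φ k) (n i) (σ i) (f i)`
converge for EVERY positive `m` and every `i` (apply `exists_strictMono_forall_tendsto_of_equicontinuous`
on the separable metric space of positive tuples; equicontinuity at `m` from the Lipschitz bound on the
compact ball of radius `min_f m_f / 2` around `m`). [folklore] -/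
theorem exists_strictMono_forall_mass_tendsto {ι : Type*} [Countable ι]
    (z shift : (Fin Nf → ℝ) → QCDField Nf → ℕ → ℝ) (hE : IsMassEquicontinuous reg z shift)
    (n : ι → ℕ) (hn : ∀ i, n i ≠ 0) (σ : (i : ι) → Fin (n i) → QCDField Nf)
    (f : (i : ι) → Fin (n i) → 𝓢(EuclideanSpace ℝ (Fin 4), ℝ))
    (hb : ∀ i, ∀ m : Fin Nf → ℝ, (∀ fl, 0 < m fl) → ∃ R : ℝ, ∀ᶠ k in atTop,
      ‖qcdLatticeSchwinger (reg.scheme m (z m) (shift m)) k (n i) (σ i) (f i)‖ ≤ R) :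
    ∃ φ : ℕ → ℕ, StrictMono φ ∧ ∀ m : Fin Nf → ℝ, (∀ fl, 0 < m fl) → ∀ i, ∃ l : ℂ,
      Tendsto (fun k => qcdLatticeSchwinger (reg.scheme m (z m) (shift m)) (φ k) (n i) (σ i) (f i))
        atTop (𝓝 l) := by
  -- the parameter space: the positive orthant as a (separable, metric) subtype
  set P : Set (Fin Nf → ℝ) := {m | ∀ fl, 0 < m fl} with hP
  let F : ℕ → ι → P → ℂ := fun k i x =>
    qcdLatticeSchwinger (reg.scheme (x : Fin Nf → ℝ) (z x) (shift x)) k (n i) (σ i) (f i)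
  have hbF : ∀ i (x : P), ∃ R : ℝ, ∀ᶠ k in atTop, ‖F k i x‖ ≤ R := fun i x => hb i x x.2
  have heqF : ∀ i (x : P), ∀ ε > (0 : ℝ), ∃ δ > (0 : ℝ), ∀ᶠ k in atTop, ∀ y : P, dist x y < δ →
      ‖F k i x - F k i y‖ < ε := by
    intro i x ε hε
    -- a compact ball of positive tuples around `x`
    have hNf : ∀ fl, 0 < (x : Fin Nf → ℝ) fl := x.2
    obtain ⟨r, hr, hrK⟩ : ∃ r > (0 : ℝ), Metric.closedBall (x : Fin Nf → ℝ) r ⊆ P := by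
      obtain ⟨r, hr, hsub⟩ := Metric.isOpen_iff.1 (isOpen_setOf_forall_pos (Nf := Nf)) x x.2
      exact ⟨r / 2, by positivity, (Metric.closedBall_subset_ball (by linarith)).trans hsub⟩
    have hK : IsCompact (Metric.closedBall (x : Fin Nf → ℝ) r) := isCompact_closedBall _ _
    obtain ⟨δ, hδ, hδε⟩ := hE.exists_forall_dist_lt (hn i) (σ i) (f i) hK hrK hε
    refine ⟨min δ r, lt_min hδ hr, Eventually.of_forall fun k y hy => ?_⟩
    have hyK : (y : Fin Nf → ℝ) ∈ Metric.closedBall (x : Fin Nf → ℝ) r := by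
      rw [Metric.mem_closedBall, dist_comm]
      exact (lt_of_lt_of_le hy (min_le_right _ _)).le
    exact hδε k x (Metric.mem_closedBall_self hr.le) y hyK (lt_of_lt_of_le hy (min_le_left _ _))
  obtain ⟨φ, hφ, hlim⟩ := exists_strictMono_forall_tendsto_of_equicontinuous F hbF heqF
  exact ⟨φ, hφ, fun m hm i => hlim i ⟨m, hm⟩⟩

/-- **The same, in the shape S2 consumes**: along `reg.restrict φ _` with the reindexed species data
`z m ∘ φ`, `shift m ∘ φ`, for every positive tuple and every listed test datum the lattice functions
converge. [folklore] -/
theorem exists_restrict_forall_mass_tendsto {ι : Type*} [Countable ι]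
    (z shift : (Fin Nf → ℝ) → QCDField Nf → ℕ → ℝ) (hE : IsMassEquicontinuous reg z shift)
    (n : ι → ℕ) (hn : ∀ i, n i ≠ 0) (σ : (i : ι) → Fin (n i) → QCDField Nf)
    (f : (i : ι) → Fin (n i) → 𝓢(EuclideanSpace ℝ (Fin 4), ℝ))
    (hb : ∀ i, ∀ m : Fin Nf → ℝ, (∀ fl, 0 < m fl) → ∃ R : ℝ, ∀ᶠ k in atTop,
      ‖qcdLatticeSchwinger (reg.scheme m (z m) (shift m)) k (n i) (σ i) (f i)‖ ≤ R) :
    ∃ (φ : ℕ → ℕ) (hφ : StrictMono φ), ∀ m : Fin Nf → ℝ, (∀ fl, 0 < m fl) → ∀ i, ∃ l : ℂ,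
      Tendsto (fun k => qcdLatticeSchwinger ((reg.restrict φ hφ.tendsto_atTop).scheme m
        (fun s j => z m s (φ j)) (fun s j => shift m s (φ j))) k (n i) (σ i) (f i)) atTop (𝓝 l) := by
  obtain ⟨φ, hφ, hlim⟩ := exists_strictMono_forall_mass_tendsto reg z shift hE n hn σ f hb
  exact ⟨φ, hφ, fun m hm i => hlim m hm i⟩

end DiagonalQCD


/-! ### §4 S2 from the compactness-ready stub (kernel-checked reduction, abstract in the UV window) -/

section Reduction

/-- **The UV window law along a reindexing (S2 of line `registered`, physical branch per mass tuple — r2)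
from ONE hypothesis over the GIVEN sequence in compactness-ready form (the registered stub
`stub_uvCompactnessReady`)** — a kernel-checked reduction, not a proof of S2, stated for an ARBITRARY
lattice-side window predicate `W Nf sch` that is stable under reindexing of the scheme together with its
species data (`hW`; the crux's three UV-window clauses are of this kind: eventual lower bounds, and the
lattice functions of the reindexed scheme ARE the reindexed lattice functions,
`qcdLatticeSchwinger_restrict_scheme`).  If for every regularisation as in S1 (mass scaling, Goldstone
bound, asymptotic scaling, and at every positive tuple the physical branch and a neutral lattice gap)
there are species renormalisations `z m, shift m` (functions of the mass tuple) and a COUNTABLE family of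
test data `i ↦ (n i, σ i, f i)` such that
(i) the family is mass-equicontinuous (`IsMassEquicontinuous`, the Arzelà–Ascoli modulus — item
`DiagonalSpine.MassEquicontinuity` asserts this shape);
(ii) on the countable family the lattice functions are bounded eventually in `k` at every positive tuple
(k-uniform bounds = UV stability WITH observables for light Wilson quarks — item
`DiagonalSpine.CalibratedTightness` shape; Bałaban's theorems control effective actions of pure
Yang–Mills only);
(iii) the window `W` holds along the ORIGINAL sequence at every positive tuple;
(iv) OS CLOSURE: at every positive tuple, along EVERY strictly increasing `φ` on which the listed lattice
functions converge, some OS data `T` carry the limits of ALL lattice `n`-point functions on off-diagonal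
real tensors;
then for every such regularisation ONE reindexing `φ → ∞` carries, at every positive tuple, species data
and OS data with `IsQCDAlong` and the window: `exists_strictMono_forall_mass_tendsto` extracts ONE `φ`
serving every positive tuple, (iv) supplies `T`, `isQCDAlong_restrict_scheme` gives `IsQCDAlong` for the
reindexed scheme with the reindexed species data, and `hW` moves the window. [folklore] -/
theorem uvWindowLaw_of_compactnessReady :
    ∀ W : (Nf : ℕ) → QCDScheme Nf → Prop,
      (∀ (Nf : ℕ) (reg : QCDRegularisation Nf) (φ : ℕ → ℕ) (hφ : Tendsto φ atTop atTop)
          (m : Fin Nf → ℝ) (z shift : QCDField Nf → ℕ → ℝ), W Nf (reg.scheme m z shift) →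
            W Nf ((reg.restrict φ hφ).scheme m (fun s j => z s (φ j)) (fun s j => shift s (φ j)))) →
      (∀ Nf : ℕ, Nf = 2 ∨ Nf = 3 → ∀ reg : QCDRegularisation Nf,
        reg.HasMassScaling → reg.HasGoldstoneBound → (reg.scheme 0 0 0).HasAsymptoticScaling →
          (∀ m : Fin Nf → ℝ, (∀ f, 0 < m f) →
            (∀ f, ∀ᶠ k in atTop, (-1 : ℝ) < (reg.scheme m 0 0).mq f k) ∧
              ∃ Δ₀ : ℝ, 0 < Δ₀ ∧ (reg.scheme m 0 0).HasNeutralLatticeMassGap Δ₀) →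
            ∃ (z shift : (Fin Nf → ℝ) → QCDField Nf → ℕ → ℝ) (ι : Type) (_ : Countable ι) (n : ι → ℕ)
              (σ : (i : ι) → Fin (n i) → QCDField Nf)
              (f : (i : ι) → Fin (n i) → 𝓢(EuclideanSpace ℝ (Fin 4), ℝ)),
              (∀ i, n i ≠ 0) ∧ IsMassEquicontinuous reg z shift ∧
              (∀ i, ∀ m : Fin Nf → ℝ, (∀ fl, 0 < m fl) → ∃ R : ℝ, ∀ᶠ k in atTop,
                ‖qcdLatticeSchwinger (reg.scheme m (z m) (shift m)) k (n i) (σ i) (f i)‖ ≤ R) ∧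
              (∀ m : Fin Nf → ℝ, (∀ f, 0 < m f) → W Nf (reg.scheme m (z m) (shift m))) ∧
              (∀ m : Fin Nf → ℝ, (∀ f, 0 < m f) → ∀ φ : ℕ → ℕ, StrictMono φ →
                (∀ i, ∃ l : ℂ, Tendsto (fun k =>
                  qcdLatticeSchwinger (reg.scheme m (z m) (shift m)) (φ k) (n i) (σ i) (f i)) atTop (𝓝 l)) →
                ∃ T : OSData (QCDField Nf) 4, ∀ n : ℕ, n ≠ 0 → ∀ (σ : Fin n → QCDField Nf)
                  (f : Fin n → 𝓢(EuclideanSpace ℝ (Fin 4), ℝ)) (F : 𝓢((Fin n → EuclideanSpace ℝ (Fin 4)), ℂ)),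
                  IsTensorOf F (fun i => ofRealTest (f i)) → IsOffDiagonal F →
                    Tendsto (fun k => qcdLatticeSchwinger (reg.scheme m (z m) (shift m)) (φ k) n σ f) atTop
                      (𝓝 (T.schwinger n σ F)))) →
      ∀ Nf : ℕ, Nf = 2 ∨ Nf = 3 → ∀ reg : QCDRegularisation Nf,
        reg.HasMassScaling → reg.HasGoldstoneBound → (reg.scheme 0 0 0).HasAsymptoticScaling →
          (∀ m : Fin Nf → ℝ, (∀ f, 0 < m f) →
            (∀ f, ∀ᶠ k in atTop, (-1 : ℝ) < (reg.scheme m 0 0).mq f k) ∧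
              ∃ Δ₀ : ℝ, 0 < Δ₀ ∧ (reg.scheme m 0 0).HasNeutralLatticeMassGap Δ₀) →
            ∃ (φ : ℕ → ℕ) (hφ : Tendsto φ atTop atTop), ∀ m : Fin Nf → ℝ, (∀ f, 0 < m f) →
              ∃ (z shift : QCDField Nf → ℕ → ℝ) (T : OSData (QCDField Nf) 4),
                IsQCDAlong ((reg.restrict φ hφ).scheme m z shift) T ∧
                  W Nf ((reg.restrict φ hφ).scheme m z shift) := by
  intro W hW hU Nf hNf reg hms hgb has hgap
  obtain ⟨z, shift, ι, hι, n, σ, f, hn, hE, hb, hWm, hC⟩ := hU Nf hNf reg hms hgb has hgap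
  haveI : Countable ι := hι
  obtain ⟨φ, hφ, hlim⟩ := exists_strictMono_forall_mass_tendsto reg z shift hE n hn σ f hb
  refine ⟨φ, hφ.tendsto_atTop, fun m hm => ?_⟩
  obtain ⟨T, hTconv⟩ := hC m hm φ hφ (hlim m hm)
  exact ⟨fun s j => z m s (φ j), fun s j => shift m s (φ j), T,
    isQCDAlong_restrict_scheme reg φ hφ.tendsto_atTop has (hgap m hm).1 (z m) (shift m) T hTconv,
    hW Nf reg φ hφ.tendsto_atTop m (z m) (shift m) (hWm m hm)⟩

end Reduction

end Summit.QuantumFields.QCD.Cruxes.ThinQCD.Registered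

end
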